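import Summits.QuantumFields.QCD.Theses.PauliWegnerSea

/-!
# Sketch — crux idea `circle-transport` for `TiltedFlatness` (item stmt-QuantumFields-14070)
crux-ideate round 1, ideator 1 (planner-cruxidea-stmt-QuantumFields-14070-1-0), 2026-08-16.

Statements only (they must elaborate; no proof is claimed).  The line: left-translate one star link
along a circle subgroup `s ↦ V·T(s)·V⁻¹` (`T(s) = diag(e^{is}, e^{-is}, 1)`, `V ∈ SU(3)` fixed).  This
single operation is (i) exactly product-Haar preserving, (ii) degree-preserving — `s ↦ det D_W` is a
trigonometric polynomial of degree ≤ 4 per flavour (`CircleBandLimitConj`, = the route's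
`PauliBandLimit` after a gauge transformation), and (iii) `e^{βK|s|}`-cheap against the Wilson tilt
(`ArcTransport`).  Iterated along an Euler word of `9` such circles per link
(`BlockFactorisation` + `UpperBlockEuler`: `SU(3) = SU(2)₁₂·SU(2)₂₃·SU(2)₁₂`, each block three
circles) it proves clause (a) with NO minimiser / Laplace / Haar-ball / Łojasiewicz input, and —
with full circles, an FGZ-style telescope (arXiv:2407.19561 §4) and the 1-D engines `ArcRemezTrig`,
`CircleSmallBallTrig` — clause (b′); `UntiltUpper` is the intermediate comparison `ν_β ≤ C(1+β)^p·Haar`.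
-/

namespace Summit.QuantumFields.QCD.Cruxes.TiltedFlatness.CircleTransport

open scoped BigOperators Classical
open MeasureTheory

/-- The diagonal circle `T(θ) = diag(e^{iθ}, e^{-iθ}, 1)` in `SU(3)`, as a property of a map
`T : ℝ → SU(3)` (same idiom as the route's `PauliBandLimit`). -/
def IsDiagCircle (T : ℝ → Matrix.specialUnitaryGroup (Fin 3) ℂ) : Prop :=
  ∀ θ : ℝ, ((T θ : Matrix.specialUnitaryGroup (Fin 3) ℂ) : Matrix (Fin 3) (Fin 3) ℂ) =
    Matrix.diagonal ![Complex.exp (θ * Complex.I), Complex.exp (-(θ * Complex.I)), 1]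

/-- `A ∈ SU(2)₁₂ ⊂ SU(3)` (block form `diag(A′, 1)`). -/
def IsUpperBlock (A : Matrix.specialUnitaryGroup (Fin 3) ℂ) : Prop :=
  (A : Matrix (Fin 3) (Fin 3) ℂ) 2 2 = 1 ∧
    ∀ i : Fin 3, i ≠ 2 → (A : Matrix (Fin 3) (Fin 3) ℂ) i 2 = 0 ∧ (A : Matrix (Fin 3) (Fin 3) ℂ) 2 i = 0

/-- `B ∈ SU(2)₂₃ ⊂ SU(3)` (block form `diag(1, B′)`). -/
def IsLowerBlock (B : Matrix.specialUnitaryGroup (Fin 3) ℂ) : Prop :=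
  (B : Matrix (Fin 3) (Fin 3) ℂ) 0 0 = 1 ∧
    ∀ i : Fin 3, i ≠ 0 → (B : Matrix (Fin 3) (Fin 3) ℂ) i 0 = 0 ∧ (B : Matrix (Fin 3) (Fin 3) ℂ) 0 i = 0

/-- EULER SURJECTIVITY, algebraic half: `SU(3) = SU(2)₁₂ · SU(2)₂₃ · SU(2)₁₂` (choose `C⁻¹e₁ ⊥ row 3 of U`,
then `A e₁ = U C⁻¹ e₁`; a unitary fixing `e₁` with `det = 1` is a lower block).  Provable now. -/
def BlockFactorisation : Prop :=
  ∀ U : Matrix.specialUnitaryGroup (Fin 3) ℂ, ∃ A B C : Matrix.specialUnitaryGroup (Fin 3) ℂ,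
    IsUpperBlock A ∧ IsLowerBlock B ∧ IsUpperBlock C ∧ U = A * B * C

/-- EULER SURJECTIVITY inside a block: every `A ∈ SU(2)₁₂` is `T(a)·(V₀T(b)V₀⁻¹)·T(c)` for ONE fixed
`V₀ ∈ SU(2)₁₂` (the element conjugating `σ₃`-rotations into `σ₂`-rotations): three circles, all
conjugates of the diagonal one.  (The lower block is the conjugate of the upper one by the cyclic
permutation matrix, `det = 1`.)  Provable now (classical `ZYZ` Euler angles of `SU(2)`). -/
def UpperBlockEuler : Prop :=
  ∀ T : ℝ → Matrix.specialUnitaryGroup (Fin 3) ℂ, IsDiagCircle T →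
    ∃ V₀ : Matrix.specialUnitaryGroup (Fin 3) ℂ, IsUpperBlock V₀ ∧
      ∀ A : Matrix.specialUnitaryGroup (Fin 3) ℂ, IsUpperBlock A →
        ∃ a b c : ℝ, A = T a * (V₀ * T b * V₀⁻¹) * T c

/-- BAND LIMIT ALONG A CONJUGATED CIRCLE ACTING ON THE LEFT OF ONE LINK: `θ ↦ det D_W(U[e ↦ V T(θ) V⁻¹ U_e])`
is a trigonometric polynomial of degree ≤ 4 (one flavour, `r = 1`), for every background, mass, edge
and `V ∈ SU(3)` — the route's `PauliBandLimit` transported by the gauge transformation `g(e.1) = V⁻¹`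
(`det D_W` is gauge invariant) and the left/right symmetry of the rank count.  Hence
`θ ↦ ‖det diracMatrix‖²` has degree ≤ `8 N_f` along every circle of the Euler word. -/
def CircleBandLimitConj : Prop :=
  open Literature.MathematicalPhysics.QuantumFieldTheory Literature.MathematicalPhysics.QuantumLattice
    Literature.Probability.LatticeModels in
  ∀ (L : ℕ) [NeZero L] (U : GaugeConfig 4 L (Matrix.specialUnitaryGroup (Fin 3) ℂ)) (m₀ : ℝ)
    (e : Edge 4 L) (T : ℝ → Matrix.specialUnitaryGroup (Fin 3) ℂ), IsDiagCircle T →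
    ∀ V : Matrix.specialUnitaryGroup (Fin 3) ℂ, ∃ c : Fin 9 → ℂ, ∀ θ : ℝ,
      (wilsonDirac (fundamentalRep (Fin 3)) (Function.update U e (V * T θ * V⁻¹ * U e)) m₀ 1).det =
        ∑ k : Fin 9, c k * Complex.exp ((((k : ℕ) : ℝ) - 4 : ℝ) * θ * Complex.I)

/-- THE LEVER — TRANSPORT INEQUALITY.  For every non-negative continuous `F` on configurations,
every star link `e`, every conjugated circle and every arc half-width `r > 0`: the tilted integral of
`F` dominates `e^{-βKr}` × the tilted integral of the arc-average of `F` along the circle at `e`.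
(Proof sketch: left-invariance of `Measure.pi haarProbability` under `W ↦ W[e ↦ g·W_e]`, Fubini over
`s ∈ [-r, r]`, and `|S(refit W[e ↦ VT(s)V⁻¹W_e]) − S(refit W)| ≤ K|s|` with `K` = twice the number
of plaquettes through `e` times `‖T′‖` — uniform in `L`, `U`, `β`, masses.)  Iterating over the
`9·16` circles of the Euler word with `r = 1/(K(1+β))` and bounding the iterated arc average from
below by `(cr)^{2·8N_f·144}·sup F` (`ArcRemezTrig` coordinate-wise + Euler surjectivity) gives
clause (a) of `TiltedFlatness` with `p = 2304·N_f`, never locating a minimiser. -/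
def ArcTransport : Prop :=
  open MeasureTheory Literature.MathematicalPhysics.QuantumFieldTheory Literature.MathematicalPhysics.QuantumLattice
    Literature.Probability.LatticeModels in
  ∃ K : ℝ, 0 < K ∧ ∀ (L : ℕ) [NeZero L], 4 ≤ L →
    ∀ (U : GaugeConfig 4 L (Matrix.specialUnitaryGroup (Fin 3) ℂ)) (x y : TorusSite 4 L) (e : Edge 4 L),
      (e.1 = x ∨ Site.shift e.1 e.2 = x ∨ e.1 = y ∨ Site.shift e.1 e.2 = y) →
    ∀ (T : ℝ → Matrix.specialUnitaryGroup (Fin 3) ℂ), IsDiagCircle T →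
    ∀ (V : Matrix.specialUnitaryGroup (Fin 3) ℂ) (β : ℝ), 0 ≤ β → ∀ r : ℝ, 0 < r →
    ∀ F : GaugeConfig 4 L (Matrix.specialUnitaryGroup (Fin 3) ℂ) → ℝ, Continuous F → (∀ W, 0 ≤ F W) →
      let star : Edge 4 L → Prop := fun e' => e'.1 = x ∨ Site.shift e'.1 e'.2 = x ∨ e'.1 = y ∨ Site.shift e'.1 e'.2 = y
      let refit : GaugeConfig 4 L (Matrix.specialUnitaryGroup (Fin 3) ℂ) →
          GaugeConfig 4 L (Matrix.specialUnitaryGroup (Fin 3) ℂ) := fun W e' => if star e' then W e' else U e'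
      let wt : GaugeConfig 4 L (Matrix.specialUnitaryGroup (Fin 3) ℂ) → ℝ :=
        fun W => Real.exp (-(β * wilsonAction (fundamentalRep (Fin 3)) (refit W)))
      let haar : Measure (GaugeConfig 4 L (Matrix.specialUnitaryGroup (Fin 3) ℂ)) :=
        Measure.pi fun _ => haarProbability (Matrix.specialUnitaryGroup (Fin 3) ℂ)
      let arcAvg : GaugeConfig 4 L (Matrix.specialUnitaryGroup (Fin 3) ℂ) → ℝ :=
        fun W => (∫ s in Set.Icc (-r) r, F (Function.update W e (V * T s * V⁻¹ * W e))) / (2 * r)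
      Real.exp (-(β * K * r)) * ∫ W, arcAvg W * wt W ∂haar ≤ ∫ W, F W * wt W ∂haar

/-- UNTILT (upper half), the consequence of transport with FULL circles + Euler surjectivity +
Lipschitz: the star-conditional tilted law is dominated by `C(1+β)^p ×` product Haar on every
measurable set (`p = #circles = 144`; no Haar-ball volume, no `S_min` localisation needed beyond
`Z ≥ e^{-1}(c/(1+β))^{p} e^{-βS_min}`).  With `Haar{F ≤ ε·sup F} ≤ C′ε^{c}` (telescope) this is (b′). -/
def UntiltUpper : Prop :=
  open MeasureTheory Literature.MathematicalPhysics.QuantumFieldTheory Literature.MathematicalPhysics.QuantumLattice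
    Literature.Probability.LatticeModels in
  ∃ C p : ℝ, 0 < C ∧ ∀ β : ℝ, 0 ≤ β → ∀ (L : ℕ) [NeZero L], 4 ≤ L →
    ∀ (U : GaugeConfig 4 L (Matrix.specialUnitaryGroup (Fin 3) ℂ)) (x y : TorusSite 4 L)
      (A : Set (GaugeConfig 4 L (Matrix.specialUnitaryGroup (Fin 3) ℂ))), MeasurableSet A →
      let star : Edge 4 L → Prop := fun e' => e'.1 = x ∨ Site.shift e'.1 e'.2 = x ∨ e'.1 = y ∨ Site.shift e'.1 e'.2 = y
      let refit : GaugeConfig 4 L (Matrix.specialUnitaryGroup (Fin 3) ℂ) →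
          GaugeConfig 4 L (Matrix.specialUnitaryGroup (Fin 3) ℂ) := fun W e' => if star e' then W e' else U e'
      let wt : GaugeConfig 4 L (Matrix.specialUnitaryGroup (Fin 3) ℂ) → ℝ :=
        fun W => Real.exp (-(β * wilsonAction (fundamentalRep (Fin 3)) (refit W)))
      let haar : Measure (GaugeConfig 4 L (Matrix.specialUnitaryGroup (Fin 3) ℂ)) :=
        Measure.pi fun _ => haarProbability (Matrix.specialUnitaryGroup (Fin 3) ℂ)
      let Z : ℝ := ∫ W, wt W ∂haar
      (∫ W in A, wt W ∂haar) / Z ≤ C * (1 + β) ^ p * (haar A).toReal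

/-- 1-D ENGINE (a): arc-to-circle Remez for NON-NEGATIVE trigonometric polynomials of degree ≤ D:
`sup_𝕋 p ≤ (C/r)^{2D} × (average of p over any arc of half-width r)`.  (Lagrange interpolation at
`2D+1` nodes of the arc, or Chebyshev; constants depend on `D` only.) -/
def ArcRemezTrig : Prop :=
  ∀ D : ℕ, ∃ C : ℝ, 0 < C ∧ ∀ a : ℤ → ℂ,
    let p : ℝ → ℂ := fun t => ∑ k ∈ Finset.Icc (-(D : ℤ)) D, a k * Complex.exp ((k : ℂ) * t * Complex.I)
    (∀ t, (p t).im = 0 ∧ 0 ≤ (p t).re) →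
    ∀ r : ℝ, 0 < r → r ≤ Real.pi → ∀ t₀ : ℝ,
      (p t₀).re ≤ (C / r) ^ (2 * D) * ((∫ s in Set.Icc (-r) r, (p s).re) / (2 * r))

/-- 1-D ENGINE (b′): mean-relative small balls on the circle for NON-NEGATIVE trigonometric
polynomials of degree ≤ D with positive mean (guard against `p ≡ 0`): `|{t : p(t) ≤ ε·mean p}| ≤ C ε^{1/(2D)}`
(FGZ arXiv:2407.19561 §4.1 eq. (12)
via the root factorisation + arcs, or Cartan's lemma `Literature.Analysis.Complex.CartanLemma`, or
Remez by interpolation on a set of given measure). -/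
def CircleSmallBallTrig : Prop :=
  ∀ D : ℕ, ∃ C c : ℝ, 0 < C ∧ 0 < c ∧ ∀ a : ℤ → ℂ,
    let p : ℝ → ℂ := fun t => ∑ k ∈ Finset.Icc (-(D : ℤ)) D, a k * Complex.exp ((k : ℂ) * t * Complex.I)
    (∀ t, (p t).im = 0 ∧ 0 ≤ (p t).re) →
    0 < (∫ s in Set.Icc (-Real.pi) Real.pi, (p s).re) →   -- guard: p ≢ 0 (else the set is everything)
    ∀ ε : ℝ, 0 < ε →
      volume {t ∈ Set.Icc (-Real.pi) Real.pi |
          (p t).re ≤ ε * ((∫ s in Set.Icc (-Real.pi) Real.pi, (p s).re) / (2 * Real.pi))}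
        ≤ ENNReal.ofReal (C * ε ^ c)

/-- Bookkeeping: the target decl of the line is the route decl, BY NAME (its text is the disprover's
`TiltedFlatnessRepaired`, `Cruxes/TiltedFlatness/Disproof.lean: repaired_iff_current := Iff.rfl`). -/
example : Summit.QuantumFields.QCD.Theses.PauliWegnerSea.TiltedFlatness →
    Summit.QuantumFields.QCD.Theses.PauliWegnerSea.TiltedFlatness := id

end Summit.QuantumFields.QCD.Cruxes.TiltedFlatness.CircleTransport
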